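import Literature.Computability.Complexity.OccurrenceObstructionsFresh
import Literature.Computability.Complexity.OccurrenceObstructionsHookTableaux
import HarnessLib

/-!
# pnp.S28 discharged: `no_occurrence_obstructions_holds` and the unconditional forms of
# Bürgisser–Ikenmeyer–Panova's "no occurrence obstructions" theorem

Topic `Literature/Computability/Complexity`, sibling proof file of `OccurrenceObstructions.lean`
(the named fact `Literature.Computability.Complexity.no_occurrence_obstructions`, **pnp.S28**) in the
sense of D-0014; theorems only, no new definitions, no statement of the tree is changed.

Source: P. Bürgisser, C. Ikenmeyer, G. Panova, *No occurrence obstructions in geometric complexity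
theory*, J. Amer. Math. Soc. 32 (2019), 163–193 = arXiv:1604.06431v3, Thm. 1.4: "Let `n, d, m`
be positive integers with `n ≥ m^25` and `λ ⊢ nd`. If `λ` occurs in `ℂ[Z_{n,m}]`, then `λ` also
occurs in `ℂ[Ω_n]`. In particular, Conjecture 1.3 is false." (Letters of this topic: permanent
size `n`, determinant size `m`, threshold `n ^ 25 ≤ m`.)

## What is assembled here, and from what

The tree proves BIP's theorem bottom-up across several files; the two top-level halves were
landed independently and are joined here:

* `OccurrenceObstructionsFresh.lean` proves
  `no_occurrence_obstructions_of_thm_6_2 (h62 : bip2019_thm_6_2) : no_occurrence_obstructions`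
  — the tree's fact (G20's fresh-variable padding `X₀₀^{m-n} per_n`, threshold `n ^ 25 ≤ m`) from
  BIP's building-block theorem Thm. 6.2 alone: for `n ≥ 4` by the case analysis of BIP §6 ("Proof
  of Theorem 1.4") run with the parameter `M = n + 1` on the discharged Props. 2.4, 6.1
  (`PlethysmStabilityBIP.lean`: plethysm stability Props. 5.6(2), 5.8(2), power sums Prop. 3.2,
  padded power sums Thm. 2.5) and Prop. 6.3 (splitting + semigroup property Lemma 2.2 + the even
  rectangles Prop. 2.3, `OccurrenceObstructionsBIP.lean`), the Kadish–Landsberg bounds Thm. 2.1 /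
  Thm. 4.9 (`OrbitClosureWeights.lean`) and the BLMW lift (`Polarization.lean`); for `n ≤ 3` by
  `Z ⊆ Ω_m` outright (`dc(per_3) ≤ 7`, Grenet) and the occurrence-obstruction principle
  (`OccurrenceObstructionsProofs.lean`).
* `OccurrenceObstructionsHookTableaux.lean` proves `bip2019_thm_6_2_holds : bip2019_thm_6_2`
  (BIP Thm. 6.2, the hook-like shapes `b × 1 + c × i + 1 × j` occur in `ℂ[Ω_m]_{3M⁴}`, by the
  explicit content tableau of BIP §7, Props. 7.2–7.3, in the abstract form of
  `TableauPositivity.lean`).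

Hence (this file): `no_occurrence_obstructions_holds` (pnp.S28 unconditionally), its two in-file
consequences `not_isOccurrenceObstruction_holds` and `not_occurrenceObstructionRoute_holds` (the
occurrence-obstruction route to the Mulmuley–Sohoni conjecture is dead), BIP's theorem AS PRINTED
for BIP's own padding `X₁₁ ∈ per` (`bip2019_no_occurrence_obstructions_holds`, the corrected
statement of `OccurrenceObstructionsBIP.lean`), and the fresh-variable statement at threshold
`(n + 1) ^ 25` (`no_occurrence_obstructions_succ_holds`). The trust base of all five is the axiom
whitelist only: every BIP ingredient (Thm. 2.1, Lemma 2.2, Props. 2.3, 2.4, Thm. 2.5, Prop. 3.2,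
Thm. 4.9, Props. 5.6(2), 5.8(2), 6.1, Thm. 6.2, Prop. 6.3) is a theorem of the tree.

Not here: the module form `CplxAlg`-style `HasOccurrenceObstruction` statements
(`bip2019_not_hasOccurrenceObstruction`, `bip_no_occurrence_obstruction_succ`), whose link to the
weight form needs complete reducibility of rational `GL_N(ℂ)`-modules (named facts of
`GLHighestWeight.lean`); nothing about multiplicity obstructions.

## References

* P. Bürgisser, C. Ikenmeyer, G. Panova, *No occurrence obstructions in geometric complexity
  theory*, J. AMS 32 (2019) 163–193 = arXiv:1604.06431v3: Thm. 1.4, Conj. 1.3, §6 (Proof of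
  Theorem 1.4), Thm. 6.2, §7. [key `BurgisserIkenmeyerPanovaJAMS2019`]

## Tree

`no_occurrence_obstructions_of_thm_6_2` (`OccurrenceObstructionsFresh.lean`),
`bip2019_thm_6_2_holds` (`OccurrenceObstructionsHookTableaux.lean`),
`bip2019_no_occurrence_obstructions_of_thm_6_2`, `no_occurrence_obstructions_succ_of_thm_6_2`,
`not_occurrenceObstructionRoute_of_thm_6_2` (`PlethysmStabilityBIP.lean`).
-/

namespace Literature.Computability.Complexity

/-- **pnp.S28 discharged** (Bürgisser–Ikenmeyer–Panova, J. AMS 32 (2019), Thm. 1.4, in the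
tree's rendering `no_occurrence_obstructions`: for `0 < n` and `n ^ 25 ≤ m`, every highest weight
of `GL_{m²}(ℂ)` occurring in the coordinate ring of the orbit closure of the padded permanent
`X₀₀^{m-n} per_n` occurs in that of `\overline{GL_{m²} · det_m}`). Assembly of the tree's two
halves: the reduction to BIP Thm. 6.2 (`no_occurrence_obstructions_of_thm_6_2`, BIP §6 "Proof of
Theorem 1.4" with `M = n + 1` for `n ≥ 4`, `Z ⊆ Ω_m` for `n ≤ 3`) and the discharge of Thm. 6.2
by the explicit tableau of BIP §7 (`bip2019_thm_6_2_holds`).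
[cite: BurgisserIkenmeyerPanovaJAMS2019, Thm. 1.4 and §6 (Proof of Theorem 1.4)] -/
theorem no_occurrence_obstructions_holds : no_occurrence_obstructions :=
  no_occurrence_obstructions_of_thm_6_2 bip2019_thm_6_2_holds

/-- **No occurrence obstruction exists once `n ^ 25 ≤ m`, `0 < n`** — discharge of the predicate
form `not_isOccurrenceObstruction` of pnp.S28 (BIP 2019, Thm. 1.4: "In particular,
Conjecture 1.3 is false"), by the proof preserved in `OccurrenceObstructions.lean`, now fed with
`no_occurrence_obstructions_holds`. [cite: BurgisserIkenmeyerPanovaJAMS2019, Thm. 1.4] -/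
theorem not_isOccurrenceObstruction_holds : not_isOccurrenceObstruction :=
  fun hn hnm χ h => h.2 (no_occurrence_obstructions_holds _ _ hn hnm χ h.1)

/-- **BIP kill the occurrence route, unconditionally**: discharge of
`not_occurrenceObstructionRoute` (`¬ OccurrenceObstructionRoute`: no family of occurrence
obstructions at all determinant sizes `n ≤ m ≤ n ^ c` exists for every `c`), via the tree's
`not_occurrenceObstructionRoute_of_thm_6_2` and `bip2019_thm_6_2_holds`.
[cite: BurgisserIkenmeyerPanovaJAMS2019, Thm. 1.4 (consequences: Conjecture 1.3 is false)] -/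
theorem not_occurrenceObstructionRoute_holds : not_occurrenceObstructionRoute :=
  not_occurrenceObstructionRoute_of_thm_6_2 bip2019_thm_6_2_holds

/-- **BIP Thm. 1.4 as printed, unconditionally**: discharge of
`bip2019_no_occurrence_obstructions` (BIP's own padded permanent `bipPaddedPerOrbitRep`, padding
variable `X₀₀` a variable OF `per_n`, threshold `n ^ 25 ≤ m`, `0 < n`), via
`bip2019_no_occurrence_obstructions_of_thm_6_2` (BIP §6 with `M = n` on the discharged
Props. 2.4, 6.1, 6.3, Thms. 2.1, 2.5, Lemma 2.2 and the BLMW lift) and `bip2019_thm_6_2_holds`.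
[cite: BurgisserIkenmeyerPanovaJAMS2019, Thm. 1.4 and §6 (Proof of Theorem 1.4)] -/
theorem bip2019_no_occurrence_obstructions_holds : bip2019_no_occurrence_obstructions :=
  bip2019_no_occurrence_obstructions_of_thm_6_2 bip2019_thm_6_2_holds

/-- **The fresh-variable statement at threshold `(n + 1) ^ 25 ≤ m`, unconditionally**: discharge
of `no_occurrence_obstructions_succ` (no positivity of `n` needed), via
`no_occurrence_obstructions_succ_of_thm_6_2` (BIP §6 with `M = n + 1`) and
`bip2019_thm_6_2_holds`. [cite: BurgisserIkenmeyerPanovaJAMS2019, §6 (Proof of Theorem 1.4), with M = n + 1] -/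
theorem no_occurrence_obstructions_succ_holds : no_occurrence_obstructions_succ :=
  no_occurrence_obstructions_succ_of_thm_6_2 bip2019_thm_6_2_holds

end Literature.Computability.Complexity
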